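import Mathlib.Tactic
import Summits.Ventures.PercRepro.C025ProfileThinGirthArithGenA

/-!
# THE `g`-CASCADE FOR EVERY `g`: THE ARITHMETIC IN CLOSED FORM — part B: THE WEIGHTS (night-3 g16)
`gen_weights_of_R`: for `g ≥ 4`, `q ≥ g (g − 2)`, `f ≥ q` and any `R` with the three properties of `genR_exists`
(`C025ProfileThinGirthArithGenA`), the weights `a_0 = 1`, `a_s = 1 + ε R_s`, `b_{s−1} = 1 − ((q+1−s)/s) ε R_s`,
`s_Q = (g−1)/(g(q+2−g))`, `ε = 1/f − s_Q`, `σ = 2/f` satisfy every hypothesis of `profileIneq_thinGirth_of_weights`: the capacities at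
`s = 1 … g−1`, the demands of the types `1 … g−2`, the top demand and the `Q'`-capacity are EXACT (the identities of part A), the type-0
demand is the KEY `gen_key` (when `ε > 0`; trivial when `ε ≤ 0`), nonnegativity and the bound `a_t, b_t ≤ f σ = 2` follow from
`0 ≤ R_s ≤ 1`, `−1 ≤ ε ≤ 1/f` and `q s_Q ≤ 1` (this is where `q ≥ g (g − 2)` enters), the (Cap)(iii) bound is `gen_capiii`.
**`gen_weights`**: the same in the shape of the matroid theorem (`n = |E|`, `f = n − q − 1 ≥ q`) — the `g`-cascade is feasible for
EVERY `g ≥ 4` and every `q ≥ g (g − 2)`, `n ≥ 2q + 1`. No matroid in this file.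
-/
namespace PercRepro
namespace ThinGirth

/-- **THE GENERAL CASCADE WEIGHTS FROM THE PRODUCTS**: for `g ≥ 4`, `q ≥ g (g − 2)`, `f ≥ q` and any `R` with the three properties of
`genR_exists`, the weights `a_0 = 1`, `a_s = 1 + ε R_s`, `b_{s−1} = 1 − ((q+1−s)/s) ε R_s`, `s_Q = (g−1)/(g(q+2−g))`, `σ = 2/f` satisfy
every hypothesis of `profileIneq_thinGirth_of_weights` (stated with `f` in place of `|E| − q − 1`). -/
theorem gen_weights_of_R (g q f : ℕ) (hg : 4 ≤ g) (hq : g * (g - 2) ≤ q) (hf : q ≤ f)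
    (R : ℕ → ℚ) (hR1 : ∀ s, 1 ≤ s → 0 ≤ R s ∧ R s ≤ 1) (hR2 : ∀ s, g ≤ s + 1 → R s = 1)
    (hR3 : ∀ s, 1 ≤ s → s + 1 ≤ g →
      R (s - 1) = ((g : ℚ) + 1 - s) * ((q : ℚ) + 1 - s) / ((s : ℚ) * ((f : ℚ) - g + s)) * R s) :
    ∃ (a b : ℕ → ℚ) (sQ σ : ℚ), (∀ t, 0 ≤ a t) ∧ (∀ t, 0 ≤ b t) ∧ 0 ≤ sQ ∧ 0 ≤ σ ∧
      (∀ t : ℕ, 1 ≤ t → t + 2 ≤ g →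
        (f : ℚ) + 1 ≤ ((g - t : ℕ) : ℚ) * b t + ((f + 1 - g + t : ℕ) : ℚ) * a t) ∧
      ((f : ℚ) ≤ (g : ℚ) * b 0 + ((f + 1 - g : ℕ) : ℚ) * a 0) ∧
      ((f : ℚ) + 1 ≤ (f : ℚ) * (a (g - 1) + sQ)) ∧
      (∀ t : ℕ, t + 2 ≤ g → a t ≤ (f : ℚ) * σ ∧ b t ≤ (f : ℚ) * σ) ∧
      (∀ s : ℕ, s + 1 ≤ g → (s : ℚ) * b (s - 1) + ((q + 1 - s : ℕ) : ℚ) * a s ≤ q + 1) ∧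
      (((q + 2 - g : ℕ) : ℚ) + ((g * (q + 2 - g) : ℕ) : ℚ) * sQ ≤ q + 1) ∧
      (∀ c : ℕ, c + 1 ≤ g → (c : ℚ) + ((c * (q + 2 - c) : ℕ) : ℚ) * σ ≤ q + 1) := by
  -- the numbers
  have h2g : 2 * g ≤ q := by
    have h2 : 2 ≤ g - 2 := by omega
    have := Nat.mul_le_mul_left g h2
    omega
  have hgq : g ≤ q := by omega
  have hG4 : (4 : ℚ) ≤ g := by exact_mod_cast hg
  have hQF : (q : ℚ) ≤ f := by exact_mod_cast hf
  have hGQ : (g : ℚ) * ((g : ℚ) - 2) ≤ q := by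
    have h : ((g * (g - 2) : ℕ) : ℚ) ≤ q := by exact_mod_cast hq
    rw [Nat.cast_mul, Nat.cast_sub (by omega)] at h
    push_cast at h
    exact h
  have hGQ' : (g : ℚ) ≤ q := by exact_mod_cast hgq
  have hF0 : (0 : ℚ) < f := by linarith
  have hF1 : (1 : ℚ) ≤ f := by linarith
  have hQG : (0 : ℚ) < (q : ℚ) + 2 - g := by linarith
  have hG0 : (0 : ℚ) < g := by linarith
  have hFne : (f : ℚ) ≠ 0 := hF0.ne'
  set sQ : ℚ := ((g : ℚ) - 1) / ((g : ℚ) * ((q : ℚ) + 2 - g)) with hsQdef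
  set ε : ℚ := 1 / (f : ℚ) - sQ with hεdef
  have hsQ0 : 0 ≤ sQ := div_nonneg (by linarith) (mul_pos hG0 hQG).le
  have hQsQ : (q : ℚ) * sQ ≤ 1 := by
    rw [hsQdef, mul_div_assoc', div_le_one (mul_pos hG0 hQG)]
    nlinarith
  have hsQ1 : sQ ≤ 1 := by
    have : (1 : ℚ) ≤ q := by linarith
    nlinarith
  have hinvF : (0 : ℚ) ≤ 1 / (f : ℚ) := by positivity
  have hε_lo : -1 ≤ ε := by linarith
  have hε_hi : ε * f ≤ 1 := by
    have h1 : (1 / (f : ℚ)) * f = 1 := by field_simp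
    have h2 : 0 ≤ sQ * f := by positivity
    rw [hεdef, sub_mul]
    linarith
  have hε_hi' : ε ≤ 1 := by
    have : 1 / (f : ℚ) ≤ 1 := by rw [div_le_one hF0]; exact hF1
    linarith
  have hε_neg : -ε ≤ sQ := by linarith
  have hy : ∀ t : ℕ, t + 2 ≤ g → 0 ≤ ((q : ℚ) - t) / (t + 1) ∧ ((q : ℚ) - t) / (t + 1) ≤ f ∧
      ((q : ℚ) - t) / (t + 1) ≤ q := by
    intro t ht
    have ht0 : (t : ℚ) ≤ q := by exact_mod_cast (by omega : t ≤ q)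
    have ht1 : (0 : ℚ) ≤ t := by positivity
    refine ⟨div_nonneg (by linarith) (by positivity), ?_, ?_⟩
    · rw [div_le_iff₀ (by positivity)]
      nlinarith
    · rw [div_le_iff₀ (by positivity)]
      nlinarith
  -- the weights
  refine ⟨fun s => if s = 0 then 1 else 1 + ε * R s,
    fun t => if t + 2 ≤ g then 1 - (((q : ℚ) - t) / (t + 1)) * ε * R (t + 1) else 1, sQ, 2 / (f : ℚ),
    ?_, ?_, hsQ0, by positivity, ?_, ?_, ?_, ?_, ?_, ?_, ?_⟩
  · -- `0 ≤ a t`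
    intro t
    dsimp only
    split_ifs with h
    · norm_num
    · obtain ⟨hR0, hR1'⟩ := hR1 t (by omega)
      exact (gen_a_bounds hε_lo hε_hi' hR0 hR1').1
  · -- `0 ≤ b t`
    intro t
    dsimp only
    split_ifs with h
    · obtain ⟨hR0, hR1'⟩ := hR1 (t + 1) (by omega)
      obtain ⟨hy0, hyF, hyQ⟩ := hy t h
      exact (gen_b_bounds hy0 hyF hyQ hε_hi hε_neg hsQ0 hQsQ hF0 (by linarith) hR0 hR1').1
    · norm_num
  · -- (Dem) for the types `1 … g − 2`: exact
    intro t ht1 ht2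
    dsimp only
    rw [if_pos ht2, if_neg (show t ≠ 0 by omega)]
    have hrec := hR3 (t + 1) (by omega) (by omega)
    rw [Nat.add_sub_cancel] at hrec
    rw [hrec]
    have e1 : ((g - t : ℕ) : ℚ) = (g : ℚ) - t := by rw [Nat.cast_sub (by omega)]
    have e2 : ((f + 1 - g + t : ℕ) : ℚ) = (f : ℚ) + 1 - g + t := by
      rw [Nat.cast_add, Nat.cast_sub (by omega)]
      push_cast
      ring
    rw [e1, e2]
    push_cast
    have := gen_dem_exact (G := (g : ℚ)) (Q := (q : ℚ)) (F := (f : ℚ)) (T := (t : ℚ)) (ε := ε) (R := R (t + 1))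
      (by positivity) (by linarith)
    linarith
  · -- (Dem) for the type `0`: the KEY `g q ε R_1 ≤ 1`
    dsimp only
    rw [if_pos rfl, if_pos (show 0 + 2 ≤ g by omega)]
    have e2 : ((f + 1 - g : ℕ) : ℚ) = (f : ℚ) + 1 - g := by
      rw [Nat.cast_sub (by omega)]
      push_cast
      ring
    have e0 : ((q : ℚ) - ((0 : ℕ) : ℚ)) / (((0 : ℕ) : ℚ) + 1) = q := by push_cast; ring
    rw [e2, e0]
    obtain ⟨hR0, hR1'⟩ := hR1 1 le_rfl
    have hkey : (g : ℚ) * q * ε * R 1 ≤ 1 := by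
      rcases lt_or_ge 0 ε with hε | hε
      · have h1 : (g : ℚ) * q * ε * R 1 ≤ (g : ℚ) * q * ε * 1 :=
          mul_le_mul_of_nonneg_left hR1' (by positivity)
        have h3 : (g : ℚ) * q * ε ≤ 1 := gen_key hG4 hGQ hQF
        linarith
      · have : 0 ≤ (g : ℚ) * q * (-ε) * R 1 :=
          mul_nonneg (mul_nonneg (mul_nonneg hG0.le (by positivity)) (by linarith)) hR0
        linarith
    linarith
  · -- the top demand: exact
    dsimp only
    rw [if_neg (show g - 1 ≠ 0 by omega), hR2 (g - 1) (by omega), hεdef]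
    have := gen_top_exact (F := (f : ℚ)) (sQ := sQ) hFne
    linarith
  · -- `a t, b t ≤ f σ = 2`
    intro t ht
    dsimp only
    have hσ : (f : ℚ) * (2 / (f : ℚ)) = 2 := by field_simp
    rw [hσ]
    constructor
    · split_ifs with h
      · norm_num
      · obtain ⟨hR0, hR1'⟩ := hR1 t (by omega)
        exact (gen_a_bounds hε_lo hε_hi' hR0 hR1').2
    · rw [if_pos ht]
      obtain ⟨hR0, hR1'⟩ := hR1 (t + 1) (by omega)
      obtain ⟨hy0, hyF, hyQ⟩ := hy t ht
      exact (gen_b_bounds hy0 hyF hyQ hε_hi hε_neg hsQ0 hQsQ hF0 (by linarith) hR0 hR1').2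
  · -- (Cap) at `s = 0 … g − 1`: exact
    intro s hs
    dsimp only
    rcases s with _ | s'
    · rw [if_pos rfl]
      have e0 : ((q + 1 - 0 : ℕ) : ℚ) = (q : ℚ) + 1 := by push_cast; ring
      rw [e0]
      simp
    · rw [if_neg (show s' + 1 ≠ 0 by omega), Nat.add_sub_cancel, if_pos (show s' + 2 ≤ g by omega)]
      have e1 : ((q + 1 - (s' + 1) : ℕ) : ℚ) = (q : ℚ) - s' := by
        rw [Nat.cast_sub (by omega)]
        push_cast
        ring
      rw [e1]
      push_cast
      have := gen_cap_exact (Q := (q : ℚ)) (S := (s' : ℚ)) (ε := ε) (R := R (s' + 1)) (by positivity)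
      linarith
  · -- the `Q'`-capacity: exact
    have e1 : ((q + 2 - g : ℕ) : ℚ) = (q : ℚ) + 2 - g := by
      rw [Nat.cast_sub (by omega)]
      push_cast
      ring
    have e2 : ((g * (q + 2 - g) : ℕ) : ℚ) = (g : ℚ) * ((q : ℚ) + 2 - g) := by
      rw [Nat.cast_mul, Nat.cast_sub (by omega)]
      push_cast
      ring
    rw [e1, e2, hsQdef]
    have := gen_capQ_exact (G := (g : ℚ)) (Q := (q : ℚ)) hG0.ne' hQG.ne'
    linarith
  · -- (Cap)(iii) for `σ = 2/f`
    intro c hc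
    exact gen_capiii hg hq hf hc

/-- **THE GENERAL CASCADE WEIGHTS**, in the shape of the hypotheses of `profileIneq_thinGirth_of_weights` with `n = |E|`,
`f = n − q − 1 ≥ q`: for every `g ≥ 4` and `q ≥ g (g − 2)` there are type weights `a b`, a top weight `s_Q` and an inner payment `σ`
with (Dem), (Cap), the `Q'`-capacity, the (Cap)(iii) bound and the `σ`-need — the `g`-cascade is feasible for EVERY `g`. -/
theorem gen_weights (g q n : ℕ) (hg : 4 ≤ g) (hq : g * (g - 2) ≤ q) (hfq : q ≤ n - q - 1) :
    ∃ (a b : ℕ → ℚ) (sQ σ : ℚ), (∀ t, 0 ≤ a t) ∧ (∀ t, 0 ≤ b t) ∧ 0 ≤ sQ ∧ 0 ≤ σ ∧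
      (∀ t : ℕ, 1 ≤ t → t + 2 ≤ g →
        ((n - q - 1 : ℕ) : ℚ) + 1 ≤ ((g - t : ℕ) : ℚ) * b t + ((n - q - g + t : ℕ) : ℚ) * a t) ∧
      (((n - q - 1 : ℕ) : ℚ) ≤ (g : ℚ) * b 0 + ((n - q - g : ℕ) : ℚ) * a 0) ∧
      (((n - q - 1 : ℕ) : ℚ) + 1 ≤ ((n - q - 1 : ℕ) : ℚ) * (a (g - 1) + sQ)) ∧
      (∀ t : ℕ, t + 2 ≤ g → a t ≤ ((n - q - 1 : ℕ) : ℚ) * σ ∧ b t ≤ ((n - q - 1 : ℕ) : ℚ) * σ) ∧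
      (∀ s : ℕ, s + 1 ≤ g → (s : ℚ) * b (s - 1) + ((q + 1 - s : ℕ) : ℚ) * a s ≤ q + 1) ∧
      (((q + 2 - g : ℕ) : ℚ) + ((g * (q + 2 - g) : ℕ) : ℚ) * sQ ≤ q + 1) ∧
      (∀ c : ℕ, c + 1 ≤ g → (c : ℚ) + ((c * (q + 2 - c) : ℕ) : ℚ) * σ ≤ q + 1) := by
  have hgq : g ≤ q := by
    have h2 : 2 ≤ g - 2 := by omega
    have := Nat.mul_le_mul_left g h2
    omega
  obtain ⟨R, hR1, hR2, hR3⟩ := genR_exists g q (n - q - 1) hgq hfq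
  obtain ⟨a, b, sQ, σ, ha, hb, hsQ, hσ, hdem, hdem0, htop, hσab, hcap, hcapQ, hcapiii⟩ :=
    gen_weights_of_R g q (n - q - 1) hg hq hfq R hR1 hR2 hR3
  have e1 : ∀ t, n - q - g + t = n - q - 1 + 1 - g + t := fun t => by omega
  have e2 : n - q - g = n - q - 1 + 1 - g := by omega
  refine ⟨a, b, sQ, σ, ha, hb, hsQ, hσ, ?_, ?_, htop, hσab, hcap, hcapQ, hcapiii⟩
  · intro t ht1 ht2
    rw [e1 t]
    exact hdem t ht1 ht2
  · rw [e2]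
    exact hdem0

end ThinGirth
end PercRepro
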